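import Summits.Ventures.HSemireg.WedgeHankelRecurrenceSplitting

/-!
# Venture HSemireg — THE CALCULUS OF NEWTON SUMS (the symbol `m′/m` is a LOGARITHMIC DERIVATIVE): for monic `m₁`, `m₂`, `m` over any field,
# **`p(m₁ · m₂) = p(m₁) + p(m₂)`**, **`p(∏ᵢ mᵢ) = Σᵢ p(mᵢ)`**, **`p(m^k) = k · p(m)`** (so in characteristic `p` every `p`-th power has ALL Newton sums zero), `p(X − c) = (c^j)_j`, `p(X^n) = (n, 0, 0, …)`,
# and under a SCALING of the roots **`p_j(c^{deg m} · m(X/c)) = c^j · p_j(m)`** (`Polynomial.scaleRoots`) — all root-free, where `p(m) := dualSeq m m′` is the lineage's Newton-sum sequence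
# (= `trace (M_X^j)` by N103, = `Σ λ^j` by N107).

HONEST FRAMING. Part of the Lean index of the computation cell `pub-hsemireg` (seat p10 gen 32, Sunday typer «UNIFORM-IN-n»).
LINEAR ALGEBRA OF HANKEL (catalecticant) MATRICES and of polynomials over a field ONLY (`Polynomial.derivative`, `Polynomial.scaleRoots`, the lineage's `dualSeq`): no variety, no cohomology theory,
no sheaf, no Ext group and no semiregularity map is constructed here; «logarithmic derivative» is dictionary only; nothing here says that HC / HC_CM / HC_AV holds; no Literature fact is declared
or used.  Custodian versions as in `WedgeHankelSiegelIdeal` (1/3).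

WHAT IS IN THE TREE.  N45 (`WedgeHankelRecurrenceSymbol`): `dualSeq_add_dualSeq` (`a/m + a′/m′ = (a m′ + a′ m)/(m m′)`), `dualSeq_mul_left_of_monic` (cancellation).  N32: `dualSeq_smul`, `dualSeq_add`,
`dualSeq_eq_zero_of_dvd`, `dualSeq_X_pow_mul`.  N80 (`WedgeHankelRecurrencePowerSums`): `dualSeq_X_sub_C_one`, `dualSeq_one_zero`, `dualSeq_prod_X_sub_C_derivative` (split products).  N107
(`WedgeHankelRecurrenceSplitting`): `dualSeq_map`, `map_dualSeq_derivative_eq_sum_roots_pow`.  N111 (`NewtonInversion`, staged): the `X^{d−p}(X − 1)^p` witness (a special case of §691's `p`-th power law).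
Mathlib: `derivative_mul`, `Finset.prod_insert`, `Polynomial.scaleRoots`, `mul_scaleRoots_of_noZeroDivisors`, `X_sub_C_scaleRoots`, `map_scaleRoots`, `monic_scaleRoots_iff`; the scaling law is
proved through the splitting field (N107's power sums): `scaleRoots` of a split monic product is the product of the `X − λ·c`.  `rg` in the lineage: no product ∕ power ∕ scaling law for `dualSeq m m′` (N80 ∕ N107 treat
products of LINEAR factors only).
THIS FILE (namespace `Summit.Ventures.HSemireg.Wedge.HankelOuter` continued; PLAIN on N107 (brings N80, N45, N32); 0 definitions):
* §690 **`dualSeq_mul_derivative_mul`** (additivity), **`dualSeq_finset_prod_derivative`** (finite products), `dualSeq_X_pow_derivative_ite` (`p(X^n) = n·[j = 0]`), `dualSeq_X_sub_C_derivative` (`p(X − c) = c^j`).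
* §691 **`dualSeq_pow_derivative_pow`** (`p(m^k) = k • p(m)`), **`dualSeq_pow_derivative_pow_of_cast_eq_zero`** (`(k : K) = 0 ⇒ p(m^k) = 0`: in characteristic `p`, `p`-th powers are Newton-silent),
  `hankelSq_dualSeq_pow_char_eq_zero` (their Newton-sum Hankel matrices vanish).
* §692 `scaleRoots_multiset_prod_X_sub_C`, **`map_dualSeq_derivative_scaleRoots`** (`p_j` of `scaleRoots m c` is `c^j · p_j(m)`, under any splitting embedding), **`dualSeq_derivative_scaleRoots`** (the same over
  `K`, through the splitting field).
Nothing Ext-side.  New names only.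
-/

open Module Polynomial
open scoped Matrix Polynomial

namespace Summit.Ventures.HSemireg.Wedge.HankelOuter

open Summit.Ventures.HSemireg.Wedge Summit.Ventures.HSemireg.Wedge.Hankel

variable (K : Type*) [Field K]

/-! ## §690. Additivity: the symbol `m′/m` is a logarithmic derivative -/

/-- **`p(m₁ · m₂) = p(m₁) + p(m₂)`**: `dualSeq (m₁ m₂) (m₁ m₂)′ = dualSeq m₁ m₁′ + dualSeq m₂ m₂′` for monic `m₁`, `m₂` (`(m₁m₂)′/(m₁m₂) = m₁′/m₁ + m₂′/m₂`, N45's addition of symbols). -/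
theorem dualSeq_mul_derivative_mul {m₁ m₂ : K[X]} (hm₁ : m₁.Monic) (hm₂ : m₂.Monic) :
    dualSeq K (m₁ * m₂) (derivative (m₁ * m₂)) = dualSeq K m₁ (derivative m₁) + dualSeq K m₂ (derivative m₂) := by
  rw [dualSeq_add_dualSeq K hm₁ hm₂, Polynomial.derivative_mul, mul_comm m₁ (derivative m₂)]

/-- **`p(∏_{i ∈ s} mᵢ) = Σ_{i ∈ s} p(mᵢ)`** for a finite family of monic polynomials. -/
theorem dualSeq_finset_prod_derivative {ι : Type*} [DecidableEq ι] (s : Finset ι) {f : ι → K[X]} (hf : ∀ i ∈ s, (f i).Monic) :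
    dualSeq K (∏ i ∈ s, f i) (derivative (∏ i ∈ s, f i)) = ∑ i ∈ s, dualSeq K (f i) (derivative (f i)) := by
  induction s using Finset.induction_on with
  | empty => rw [Finset.prod_empty, Finset.sum_empty, Polynomial.derivative_one, dualSeq_one_zero]
  | insert i s hi ih =>
    rw [Finset.prod_insert hi, Finset.sum_insert hi, dualSeq_mul_derivative_mul K (hf i (Finset.mem_insert_self i s)) (Polynomial.monic_prod_of_monic _ _ fun j hj => hf j (Finset.mem_insert_of_mem hj)),
      ih fun j hj => hf j (Finset.mem_insert_of_mem hj)]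

/-- `p(X − c) = (c^j)_j` (N80, renamed into the Newton-sum family). -/
theorem dualSeq_X_sub_C_derivative (c : K) : dualSeq K (Polynomial.X - C c) (derivative (Polynomial.X - C c)) = fun j => c ^ j := by
  rw [Polynomial.derivative_X_sub_C, dualSeq_X_sub_C_one]

/-- `p_j(X^n) = n · [j = 0]`: the Newton sums of `X^n` are `n` in degree `0` and `0` beyond. -/
theorem dualSeq_X_pow_derivative_ite (n j : ℕ) : dualSeq K ((Polynomial.X : K[X]) ^ n) (derivative ((Polynomial.X : K[X]) ^ n)) j = if j = 0 then (n : K) else 0 := by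
  have h := congrFun (dualSeq_multiset_prod_X_sub_C_derivative K (n • ({0} : Multiset K))) j
  rw [Multiset.map_nsmul, Multiset.map_singleton, map_zero, sub_zero, Multiset.prod_nsmul, Multiset.prod_singleton] at h
  rw [h, Multiset.map_nsmul, Multiset.map_singleton, Multiset.sum_nsmul, Multiset.sum_singleton, nsmul_eq_mul]
  split_ifs with hj
  · rw [hj, pow_zero, mul_one]
  · rw [zero_pow hj, mul_zero]

/-! ## §691. Powers: `p(m^k) = k · p(m)`; `p`-th powers are Newton-silent in characteristic `p` -/

/-- **`p(m^k) = k • p(m)`**: `dualSeq (m^k) (m^k)′ = k • dualSeq m m′` for monic `m`. -/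
theorem dualSeq_pow_derivative_pow {m : K[X]} (hm : m.Monic) (k : ℕ) : dualSeq K (m ^ k) (derivative (m ^ k)) = k • dualSeq K m (derivative m) := by
  induction k with
  | zero => rw [pow_zero, Polynomial.derivative_one, dualSeq_one_zero, zero_smul]
  | succ k ih => rw [pow_succ, dualSeq_mul_derivative_mul K (hm.pow k) hm, ih, add_smul, one_smul]

/-- **If `(k : K) = 0` then `p(m^k) = 0`** (`m` monic): in characteristic `p`, every `p`-th power (more generally every `k`-th power with `p ∣ k`) has ALL Newton sums equal to zero — the source of
every positive-characteristic witness in N110 ∕ N111 (`X^p`, `X^{d−p}(X − 1)^p`). -/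
theorem dualSeq_pow_derivative_pow_of_cast_eq_zero {m : K[X]} (hm : m.Monic) {k : ℕ} (hk : (k : K) = 0) : dualSeq K (m ^ k) (derivative (m ^ k)) = 0 := by
  rw [dualSeq_pow_derivative_pow K hm k, ← Nat.cast_smul_eq_nsmul K, hk, zero_smul]

/-- Hence the square Hankel matrix of the Newton sums of `m^k` VANISHES when `(k : K) = 0` (`m` monic; any `t`). -/
theorem hankelSq_dualSeq_pow_derivative_eq_zero {m : K[X]} (hm : m.Monic) {k : ℕ} (hk : (k : K) = 0) (t : ℕ) : hankelSq K t (dualSeq K (m ^ k) (derivative (m ^ k))) = 0 := by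
  ext i j
  rw [dualSeq_pow_derivative_pow_of_cast_eq_zero K hm hk]
  rfl

/-! ## §692. Scaling the roots: `p_j(scaleRoots m c) = c^j · p_j(m)` -/

/-- For a multiset of nodes, `scaleRoots (∏ (X − λ)) c = ∏ (X − λ·c)` (Mathlib `X_sub_C_scaleRoots` through products). -/
theorem scaleRoots_multiset_prod_X_sub_C (s : Multiset K) (c : K) :
    ((s.map fun a => Polynomial.X - C a).prod).scaleRoots c = ((s.map fun a => a * c).map fun a => Polynomial.X - C a).prod := by
  induction s using Multiset.induction_on with
  | empty => rw [Multiset.map_zero, Multiset.map_zero, Multiset.map_zero, Multiset.prod_zero, Polynomial.one_scaleRoots]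
  | cons a s ih => rw [Multiset.map_cons, Multiset.map_cons, Multiset.map_cons, Multiset.prod_cons, Multiset.prod_cons, Polynomial.mul_scaleRoots_of_noZeroDivisors, ih, Polynomial.X_sub_C_scaleRoots]

/-- **SCALING THE ROOTS MULTIPLIES THE `j`-TH NEWTON SUM BY `c^j`: `φ (p_j(scaleRoots m c)) = φ(c)^j · φ(p_j(m))`** for `m` monic and any embedding `φ` under which `m` splits (the roots of
`scaleRoots m c` are the `c·λ`). -/
theorem map_dualSeq_derivative_scaleRoots {L : Type*} [Field L] (φ : K →+* L) {m : K[X]} (hm : m.Monic) (hs : (m.map φ).Splits) (c : K) (j : ℕ) :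
    φ (dualSeq K (m.scaleRoots c) (derivative (m.scaleRoots c)) j) = φ c ^ j * φ (dualSeq K m (derivative m) j) := by
  have hmc : (m.scaleRoots c).Monic := (Polynomial.monic_scaleRoots_iff c).mpr hm
  have hmap : (m.scaleRoots c).map φ = (m.map φ).scaleRoots (φ c) := Polynomial.map_scaleRoots m c φ (by rw [hm.leadingCoeff, map_one]; exact one_ne_zero)
  have h1 := congrFun (dualSeq_map K φ hmc (derivative (m.scaleRoots c))) j
  rw [← Polynomial.derivative_map, hmap, hs.eq_prod_roots_of_monic (hm.map φ), scaleRoots_multiset_prod_X_sub_C, dualSeq_multiset_prod_X_sub_C_derivative] at h1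
  rw [← h1, map_dualSeq_derivative_eq_sum_roots_pow K φ hm hs j, ← Multiset.sum_map_mul_left]
  show (Multiset.map (fun x => x ^ j) (Multiset.map (fun a => a * φ c) (m.map φ).roots)).sum = _
  rw [Multiset.map_map]
  exact congrArg _ (Multiset.map_congr rfl fun a _ => by simp only [Function.comp_apply, mul_pow, mul_comm])

/-- **`p_j(scaleRoots m c) = c^j · p_j(m)`** over `K` itself (`m` monic; through the splitting field of `m`). -/
theorem dualSeq_derivative_scaleRoots {m : K[X]} (hm : m.Monic) (c : K) (j : ℕ) :
    dualSeq K (m.scaleRoots c) (derivative (m.scaleRoots c)) j = c ^ j * dualSeq K m (derivative m) j := by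
  apply (algebraMap K m.SplittingField).injective
  rw [map_dualSeq_derivative_scaleRoots K (algebraMap K m.SplittingField) hm (SplittingField.splits m) c j, map_mul, map_pow]

end Summit.Ventures.HSemireg.Wedge.HankelOuter
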